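import Literature.MathematicalPhysics.QuantumFieldTheory.Balaban1983to89.B5Hk163TorusHolderDecay
import Literature.MathematicalPhysics.QuantumFieldTheory.Balaban1983to89.B5DPD126Uniform
import Literature.MathematicalPhysics.QuantumFieldTheory.Balaban1983to89.B4StripSumsHolder

/-!
# `Balaban1983to89.B5Hk163TorusHolderRate` — the decaying Hölder bound for the typed torus `∂_νH_k` AT THE FULL
RATE, by the route the paper points to, and its volume-uniform sup form
(cell GAPS G-b05g11-2 (i)+(ii); successor of `B5Hk163TorusHolderDecay`, `B5Hk163TorusHolder`, `B5Hk163Torus`;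
the strip Hölder phase estimate of [2] is `B4StripSumsHolder.holderFactor_le` BY NAME)

T. Bałaban, *Propagators and renormalization transformations for lattice gauge theories. I*, Commun. Math. Phys.
**95**, 17–40 (1984) [`Balaban1984PropagatorsI`, cell paper B5].  PRINTED TEXT (locations only; renders
`1984-cmp95-propagators-rt-I-p012/p013` = journal pp.28/29, verified by this seat): p.28 last two lines – p.29 lines
1–2, right after (1.63): «Another important property is that the sum over l of the absolute value of this
expression multiplied by |∂_ν(p′+l)||p′+l|^α is bounded by a constant dependent on d only. This implies bounds on
(1/|x′−x|^α)|∂_ν(H_kB)_μ(x′) − ∂_ν(H_kB)_μ(x)| (see the proof of Lemma 2.4 in [2].)»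
Its reference [2] is T. Bałaban, *Regularity and decay of lattice Green's functions*, Commun. Math. Phys. **89**,
571–597 (1983) [`Balaban1983RegularityDecay`, cell paper B4], whose proof of Lemma 2.4 (renders
`1983-cmp89-regularity-decay-p015/p016` = journal pp.585/586, verified by this seat) treats the Hölder quotient by
inserting the factor «(1/|x−x′|^α)(e^{i(p′+l)·(x−x′)} − 1)» into the momentum `l`-sum ((2.49); «and we have assumed
that |x′−y| ≦ |x−y|.»), bounding «(1/|x−x′|^α)|e^{i(p′+l)·(x−x′)} − 1| ≦ O(1)|p′+l|^α,» with «the constant depends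
on α < 1.» (2.51), and concluding «Shifting the domain of integration in (2.49) into a complex domain in the
direction of the vector x′−y, we can bound the left hand side of (2.49) by a constant depending on α multiplied by
the exponential factor e^{−δ₀|x′−y|} = e^{−δ₀dist({x,x′},y)}. We get the inequality (2.36).»
Everything typed below (the torus model `T_η → T₁` with unitary gauge `U = 1`, `m² = 0`, the multiplier, the strip,
the alias-size weight, the metric and all constants) is OUR reading, outside «».
v1.0.1 = DOCSTRING-ONLY (code byte-identical to v1): the docstring of `norm_fdiff_HkOp_mulVec_sub_le_rate_sup` now
names the LOCAL §5a lemma `sum_exp_torusSupNorm_sub_rep_le` (v1 qualified it with the sibling namespace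
`B5Hk163TorusHolderDecay`, where no such declaration exists; cross-read advisory A1).

WHAT THIS MODULE ADDS to `B5Hk163TorusHolderDecay` (whose decaying Hölder bound was obtained by interpolation and
decays only at the degraded rate `δ(1−α)/(1+α)`): THE PRINTED ROUTE — analytic continuation and contour shift of
the Hölder-difference multiplier itself — hence the FULL rate `δ = κ₁₆₃(d+1)/(d+1)` for every `0 ≤ α < 1`, and the
volume-uniform sup-in-`B` form.

* §1 `wW`, `weighted_alias_sum_W_le`: the STRIP weighted alias sum with the ALIAS-SIZE weight
  `‖∂_ν(p′+l)‖·(1 + W_n(l))^{α/2}` (King's `B4StripSums.W`, `(1 + W_n(l))^{1/2} ≍ |l|`) is bounded by the SAME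
  constant `B5Hk163Holder.CHolder163 d α` (same per-alias majorants as `B5Hk163Holder.weighted_alias_sum_le`).
* §2 `HD163 n μ λ ν a z` — the HÖLDER-DIFFERENCE MULTIPLIER
  `HD_{ν,a,z}(p′) = Σ_l (e^{i(p′+l)·ηz} − 1)·e^{i(p′+l)·ηa}·∂_ν(p′+l)·h_{l;μλ}(p′)`, the displacement phase continued
  to complex `p′` as the signed character `B4StripSumsHolder.PhZ`: side periodicity `HD163_tr`, holomorphy, the
  STRIP BOUND `‖HD_{ν,a,z}(p′)‖ ≤ (e^κ)^{d+1}·C_H(d)·CHolder163 (d+1) α·(|z|_∞/n)^α` for `0 < |z|_∞ ≤ n`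
  (`norm_HD163_le` = `B4StripSumsHolder.holderFactor_le` × §1), `stripRegular_HD163` and the torus-kernel decay
  `torusKernel_HD163_decay` (`B4TorusKernel.MultiPeriod.torusKernel_descend_decay_torusMetric` BY NAME).
* §3 the dictionary `dker_transl_sub_bpt`: `∂_νH_k(n·ȳ′+a+z̄, y) − ∂_νH_k(n·ȳ′+a, y) = hdgker a z (y′−y)`
  (`B5Hk163TorusHolder.dker_transl_sub`; at grid momenta `PhZ` IS the fine torus character, `PhZ_ofRealVec_sOf`).
* §4 `norm_dker_transl_sub_bpt_le` (small displacements, by the contour shift) and THE FULL-RATE DECAYING HÖLDER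
  BOUND `norm_dker_sub_le_rate`: for fine points `x₁ = n·ȳ₁ + a₁`, `x₂ = n·ȳ₂ + a₂ = x₁ + z̄` and `0 ≤ α < 1`,
  `|∂_νH_k((x₂,μ),(x̄,λ)) − ∂_νH_k((x₁,μ),(x̄,λ))| ≤ CHR(d,α)·(|z|_∞/n)^α·max(e^{−δ|y₂−x|_T}, e^{−δ|y₁−x|_T})`
  (`|z|_∞ > n`: the two decaying sup bounds `B5Hk163TorusHolderDecay.norm_dker_bpt_le`; `z = 0`: trivial); the
  Euclidean-length corollary `norm_dker_sub_le_rate_euclid` and the operator form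
  `norm_fdiff_HkOp_mulVec_sub_le_rate` (exponentially weighted `ℓ¹` sum of `|B|`).
* §5 the VOLUME-UNIFORM SUP FORM `norm_fdiff_HkOp_mulVec_sub_le_rate_sup`:
  `|∂_ν(H_kB)_μ(x₂) − ∂_ν(H_kB)_μ(x₁)| ≤ CHRsup(d,α)·(|z|_∞/n)^α·sup|B|`, the torus sums of the decay factors being
  bounded by King's lattice constant `B4Sect5Proof.latticeConst (d+1) δ` uniformly in the period vector
  (`sum_exp_torusSupNorm_sub_rep_le`: `B4Sect5Torus.torusSum_le` BY NAME through `B5DPD126Uniform.tdist_eq_torusSupNorm`).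

HONEST LIMITS. (i) `α < 1` strictly, and ALL Hölder constants of this lineage DIVERGE as `α ↑ 1`:
`CHolder163 (d+1) α` (hence `MHD`, `CHR`, `CHRsup` here, and likewise `CHolderTorus`, `CHD` of the two predecessor
modules) carries the factor `zetaS(1 + (1−α)/(d+1))^{d+1}` with its pole at `α = 1` — our typed counterpart of the
printed «the constant depends on α < 1.» of [2]; the constants depend on `d` AND `α` and are ours (this also records
the cross-reader's non-blocking DOCFIX-LOW D1 on `B5Hk163TorusHolderDecay`, cell GAPS C-adv4-91). (ii) Torus model,
`U = 1`, `m² = 0`, as in the whole typed (1.63) chain; `|x′−x|` is represented by `|z|_∞/n` (or `‖z‖₂/n`) for ANY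
integer representative `z` of the displacement; decay is measured in the torus sup-metric between the COARSE block
indices `ȳ_i` and the source point. (iii) The alias-size weight `(1 + W_n(l))^{α/2}` replaces the printed `|p′+l|^α`;
the comparison of the two weights is not typed (not needed for the consequence). (iv) The typed statements
`R∂*H_kB = 0` / minimum property of the typed `H_k` are NOT addressed (cell GAPS G-b05g11-2 (iii)). No Mathlib gap.
VALUE: a kernel certificate of one printed consequence of (1.63), by the printed route, in the cell's torus model —
NOT summit progress.
-/

open scoped BigOperators Matrix ComplexConjugate Real
open Finset Complex

namespace Literature.MathematicalPhysics.QuantumFieldTheory.Balaban1983to89.B5Hk163TorusHolderRate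

open Literature.MathematicalPhysics.QuantumFieldTheory.Balaban1983to89.B4Strip (ofRealVec Strip shiftr)
open Literature.MathematicalPhysics.QuantumFieldTheory.Balaban1983to89.B4StripCauchy (Fat strip_subset_fat rOf)
open Literature.MathematicalPhysics.QuantumFieldTheory.Balaban1983to89.B4ContourShift (BZ StripRegular supNorm
  abs_le_supNorm supNorm_nonneg insertNth_mem_Strip openRect_subset_closedRect)
open Literature.MathematicalPhysics.QuantumFieldTheory.Balaban1983to89.B4TorusKernel (descendC descendC_apply
  face_match rep_mem periodConst)
open Literature.MathematicalPhysics.QuantumFieldTheory.Balaban1983to89.B4TorusKernel.MultiPeriod (torusSum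
  torusKernel torusSupNorm torusKernel_descend_decay_torusMetric)
open Literature.MathematicalPhysics.QuantumFieldTheory.Balaban1983to89.B4StripSums (omega omega_pos one_le_omega
  omega_zero W W_nonneg one_le_W omega_sq_le_W)
open Literature.MathematicalPhysics.QuantumFieldTheory.Balaban1983to89.B4StripSumsDeriv (zetaS)
open Literature.MathematicalPhysics.QuantumFieldTheory.Balaban1983to89.B4StripSumsHolder (efZ PhZ CH CH_nonneg
  holderFactor_le PhZ_tr differentiableAt_PhZ one_le_supNorm W_zero)
open Literature.MathematicalPhysics.QuantumFieldTheory.Balaban1983to89.B5Prop11Plancherel (Tor chi fine sOf fdiff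
  conj_chi chi_add_right abs_sOf_le)
open Literature.MathematicalPhysics.QuantumFieldTheory.Balaban1983to89.B5Prop11Fiber (dSym)
open Literature.MathematicalPhysics.QuantumFieldTheory.Balaban1983to89.B5Block118 (up iota bpt pOf chi_pOf_up)
open Literature.MathematicalPhysics.QuantumFieldTheory.Balaban1983to89.B5Strip145Analytic (sigma sigmaEquiv tr
  kappa_small)
open Literature.MathematicalPhysics.QuantumFieldTheory.Balaban1983to89.B5Strip145Decay (differentiableAt_insertNth
  tr_insertNth_left insertNth_left_mem)
open Literature.MathematicalPhysics.QuantumFieldTheory.Balaban1983to89.B5Hk163Strip (dC dC_ofReal h163 kappa163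
  kappa163_pos kappa163_le_rOf norm_h163_le M163 differentiable_dC differentiableAt_h163)
open Literature.MathematicalPhysics.QuantumFieldTheory.Balaban1983to89.B5Hk163Alias (dC_tr h163_tr)
open Literature.MathematicalPhysics.QuantumFieldTheory.Balaban1983to89.B5Hk163Holder (CHolder163 cWt cWt_nonneg
  cHW cHW_nonneg norm_dC_le_omega norm_h163_le_W W_rpow_le_prod163 sum_prod_rpow_le163)
open Literature.MathematicalPhysics.QuantumFieldTheory.Balaban1983to89.B5Hk163Decay (phase163 norm_phase163_le
  differentiable_phase163 phase163_tr)
open Literature.MathematicalPhysics.QuantumFieldTheory.Balaban1983to89.B5Kernel166Decay (torFin card_Tor_cast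
  toT_sub chi_toT_eq_mFourier two_pi_rep_grid chi_neg_comm)
open Literature.MathematicalPhysics.QuantumFieldTheory.Balaban1983to89.B5Hk163Torus (HkOp phase163_sOf)
open Literature.MathematicalPhysics.QuantumFieldTheory.Balaban1983to89.B5Hk163TorusHolder (zlen zlen_nonneg dker
  fdiff_HkOp_mulVec dker_transl_sub stdAddChar_pOf_mul_intCast)
open Literature.MathematicalPhysics.QuantumFieldTheory.Balaban1983to89.B5Hk163TorusHolderDecay (CdecD
  CdecD_nonneg norm_dker_bpt_le)
open Literature.MathematicalPhysics.QuantumFieldTheory.Balaban1983to89.B6LowerBound2153Torus (toT rep toT_rep)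
open Literature.MathematicalPhysics.QuantumFieldTheory.Balaban1983to89.B6Cov2156Torus (one_le_M)
open Literature.MathematicalPhysics.QuantumFieldTheory.Balaban1983to89.B4Sect5Proof (latticeConst)
open Literature.MathematicalPhysics.QuantumFieldTheory.Balaban1983to89.B4Sect5Torus (tdist)
open Literature.MathematicalPhysics.QuantumFieldTheory.Balaban1983to89.B5QGGQ145Bounds (toZ)
open Literature.MathematicalPhysics.QuantumFieldTheory.Balaban1983to89.B5DPD126Uniform (tdist_eq_torusSupNorm)
open Literature.MathematicalPhysics.QuantumFieldTheory.Balaban1983to89.B4TorusKernel.MultiPeriod (translate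
  torusSupNorm_translate)

noncomputable section

variable {d : ℕ}

/-! ## §1. The `W`-weighted alias sum on the strip -/

section WeightedSum

variable (n : ℕ) [NeZero n]

/-- the `W`-FORM HÖLDER WEIGHT `‖∂_ν(p′+l)‖·(1 + W_n(l))^{α/2}` — the alias size `(1 + W_n(l))^{1/2} ≍ 1 + |l|`
(King's `B4StripSums.W`) in place of the lattice length of `p′+l` of `B5Hk163Holder.wt163`; this is the weight the
strip Hölder phase estimate `B4StripSumsHolder.holderFactor_le` produces. [folklore] -/
def wW (k : Fin d → Fin n) (p : Fin d → ℂ) (ν : Fin d) (α : ℝ) : ℝ := ‖dC n k p ν‖ * (1 + W n k) ^ (α / 2)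

omit [NeZero n] in
/-- `wW ≥ 0`. [folklore] -/
theorem wW_nonneg (k : Fin d → Fin n) (p : Fin d → ℂ) (ν : Fin d) (α : ℝ) : 0 ≤ wW n k p ν α :=
  mul_nonneg (norm_nonneg _) (Real.rpow_nonneg (by linarith [W_nonneg n k]) _)

omit [NeZero n] in
/-- `34 ≤ c_wt(d) = 289·√(d+1)`. [folklore] -/
theorem thirtyfour_le_cWt (d : ℕ) : (34 : ℝ) ≤ cWt d := by
  unfold cWt
  have hd : (0 : ℝ) ≤ d := Nat.cast_nonneg d
  have h : (1 : ℝ) ≤ Real.sqrt ((d : ℝ) + 1) := by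
    have h1 := Real.sqrt_le_sqrt (show (1 : ℝ) ≤ (d : ℝ) + 1 by linarith)
    rwa [Real.sqrt_one] at h1
  nlinarith

/-- for `l ≠ 0`: `wW ≤ c_wt(d)·W_n(l)^{(1+α)/2}` on the strip (`‖∂_ν(p′+l)‖ ≤ 17ω_n(l_ν) ≤ 17 W^{1/2}`,
`(1+W)^{α/2} ≤ 2W^{α/2}`, `34 ≤ c_wt`). [folklore] -/
theorem wW_le_of_ne {κ : ℝ} (hκ1 : κ ≤ 1) {p : Fin d → ℂ} (hp : p ∈ Strip d κ) (k : Fin d → Fin n)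
    (hk : k ≠ fun _ => 0) (ν : Fin d) {α : ℝ} (hα0 : 0 ≤ α) (hα1 : α ≤ 1) :
    wW n k p ν α ≤ cWt d * W n k ^ ((1 + α) / 2) := by
  have hW1 := one_le_W n k hk
  have hW0 : 0 < W n k := by linarith
  have h1 : ‖dC n k p ν‖ ≤ 17 * Real.sqrt (W n k) := by
    have h := norm_dC_le_omega n hκ1 hp k ν
    have hω : omega n (k ν) ≤ Real.sqrt (W n k) := by
      rw [← Real.sqrt_sq (omega_pos n (k ν) (k ν).isLt).le]
      exact Real.sqrt_le_sqrt (omega_sq_le_W n k hk ν)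
    nlinarith
  have h2 : (1 + W n k) ^ (α / 2) ≤ 2 * W n k ^ (α / 2) := by
    have h21 : (1 + W n k) ^ (α / 2) ≤ (2 * W n k) ^ (α / 2) :=
      Real.rpow_le_rpow (by linarith) (by linarith) (by linarith)
    have h22 : (2 : ℝ) ^ (α / 2) ≤ 2 := by
      calc (2 : ℝ) ^ (α / 2) ≤ (2 : ℝ) ^ (1 : ℝ) := Real.rpow_le_rpow_of_exponent_le (by norm_num) (by linarith)
        _ = 2 := Real.rpow_one 2
    rw [Real.mul_rpow (by norm_num) hW0.le] at h21
    exact h21.trans (mul_le_mul_of_nonneg_right h22 (Real.rpow_nonneg hW0.le _))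
  have hsqrtW : Real.sqrt (W n k) = W n k ^ ((1 : ℝ) / 2) := Real.sqrt_eq_rpow (W n k)
  unfold wW
  calc ‖dC n k p ν‖ * (1 + W n k) ^ (α / 2)
      ≤ (17 * Real.sqrt (W n k)) * (2 * W n k ^ (α / 2)) :=
        mul_le_mul h1 h2 (Real.rpow_nonneg (by linarith) _) (by positivity)
    _ = 34 * (W n k ^ ((1 : ℝ) / 2) * W n k ^ (α / 2)) := by rw [hsqrtW]; ring
    _ = 34 * W n k ^ ((1 + α) / 2) := by rw [← Real.rpow_add hW0]; congr 1; congr 1; ring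
    _ ≤ cWt d * W n k ^ ((1 + α) / 2) :=
        mul_le_mul_of_nonneg_right (thirtyfour_le_cWt d) (Real.rpow_nonneg hW0.le _)

/-- at the zero alias: `wW n 0 p′ ν α ≤ 17 ≤ c_wt(d)` (`W_n(0) = 0`, `‖∂_ν p′‖ ≤ 17ω_n(0) = 17`). [folklore] -/
theorem wW_zero_le {κ : ℝ} (hκ1 : κ ≤ 1) {p : Fin d → ℂ} (hp : p ∈ Strip d κ) (ν : Fin d) (α : ℝ) :
    wW n (fun _ => 0) p ν α ≤ cWt d := by
  have hn : 1 ≤ n := Nat.one_le_iff_ne_zero.mpr (NeZero.ne n)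
  have h1 : ‖dC n (fun _ => 0) p ν‖ ≤ 17 := by
    have h := norm_dC_le_omega n hκ1 hp (fun _ => 0) ν
    simp only [Fin.val_zero, omega_zero n hn, mul_one] at h
    exact h
  unfold wW
  rw [W_zero, add_zero, Real.one_rpow, mul_one]
  linarith [thirtyfour_le_cWt d]

/-- per-alias term for `l ≠ 0` (pattern `B5Hk163Holder.weighted_term_le`, weight `wW`):
`‖h_l‖·wW_l ≤ c_HW·c_wt·Π_ν 12·ω_n(l_ν)^{−(1+(1−α)/d)}`. [folklore] -/
theorem weighted_term_W_le {κ : ℝ} (hκ0 : 0 ≤ κ) (hκ : κ ≤ kappa163 d) {p : Fin d → ℂ} (hp : p ∈ Strip d κ)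
    (μ lam ν₀ : Fin d) (k : Fin d → Fin n) (hk : k ≠ fun _ => 0) {α : ℝ} (hα0 : 0 ≤ α) (hα1 : α ≤ 1) :
    ‖h163 n μ lam k p‖ * wW n k p ν₀ α ≤
      cHW d * cWt d * ∏ ν, (12 * omega n (k ν) ^ (-(1 + (1 - α) / d))) := by
  have hd : 0 < d := Fin.pos μ
  have hκ1 : κ ≤ 1 := (kappa_small hκ0 (hκ.trans (kappa163_le_rOf d))).1
  have hW1 := one_le_W n k hk
  have hW0 : 0 < W n k := by linarith
  have hC0 : 0 ≤ cHW d * cWt d := mul_nonneg (cHW_nonneg d) (cWt_nonneg d)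
  have hA0 : 0 ≤ ∏ ν, 12 / omega n (k ν) :=
    Finset.prod_nonneg (fun ν _ => div_nonneg (by norm_num) (omega_pos n (k ν) (k ν).isLt).le)
  have hh := norm_h163_le_W n hκ0 hκ hp μ lam k hk
  have hw := wW_le_of_ne n hκ1 hp k hk ν₀ hα0 hα1
  have step2 : (1 / W n k) * W n k ^ ((1 + α) / 2) = W n k ^ ((α - 1) / 2) := by
    rw [show (α - 1) / 2 = (1 + α) / 2 - 1 by ring, Real.rpow_sub_one hW0.ne']
    ring
  have step3 := W_rpow_le_prod163 n hd k hk hα1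
  have step4 : (∏ ν, 12 / omega n (k ν)) * (∏ ν, omega n (k ν) ^ (-((1 - α) / d))) =
      ∏ ν, (12 * omega n (k ν) ^ (-(1 + (1 - α) / d))) := by
    rw [← Finset.prod_mul_distrib]
    refine Finset.prod_congr rfl (fun ν _ => ?_)
    have hω := omega_pos n (k ν) (k ν).isLt
    rw [div_eq_mul_inv, ← Real.rpow_neg_one, mul_assoc, ← Real.rpow_add hω]
    congr 1; congr 1; ring
  calc ‖h163 n μ lam k p‖ * wW n k p ν₀ α
      ≤ (cHW d * ((∏ ν, 12 / omega n (k ν)) * (1 / W n k))) * (cWt d * W n k ^ ((1 + α) / 2)) :=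
        mul_le_mul hh hw (wW_nonneg n k p ν₀ α) (mul_nonneg (cHW_nonneg d) (mul_nonneg hA0 (by positivity)))
    _ = cHW d * cWt d * ((∏ ν, 12 / omega n (k ν)) * ((1 / W n k) * W n k ^ ((1 + α) / 2))) := by ring
    _ = cHW d * cWt d * ((∏ ν, 12 / omega n (k ν)) * W n k ^ ((α - 1) / 2)) := by rw [step2]
    _ ≤ cHW d * cWt d * ((∏ ν, 12 / omega n (k ν)) * ∏ ν, omega n (k ν) ^ (-((1 - α) / d))) :=
        mul_le_mul_of_nonneg_left (mul_le_mul_of_nonneg_left step3 hA0) hC0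
    _ = cHW d * cWt d * ∏ ν, (12 * omega n (k ν) ^ (-(1 + (1 - α) / d))) := by rw [step4]

/-- **THE `W`-WEIGHTED ALIAS SUM ON THE STRIP**: for `d ≥ 1`, every `n ≥ 1`, `0 ≤ κ ≤ κ₁₆₃(d)`, `p′ ∈ Strip d κ`,
`μ, λ, ν` and `0 ≤ α < 1`: `Σ_l ‖h_{l;μλ}(p′)‖·‖∂_ν(p′+l)‖·(1 + W_n(l))^{α/2} ≤ C_H(d, α)` — the SAME constant
`B5Hk163Holder.CHolder163` (pattern `B5Hk163Holder.weighted_alias_sum_le`; the two weights obey the same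
per-alias majorants). [cite: Balaban1984PropagatorsI, p.28 last two lines – p.29 line 1 «the sum over l of the absolute value of this expression multiplied by |∂_ν(p′+l)||p′+l|^α is bounded by a constant dependent on d only.» (text of the claim; the alias-size weight, the strip and the constant ours)] [folklore] -/
theorem weighted_alias_sum_W_le {κ : ℝ} (hκ0 : 0 ≤ κ) (hκ : κ ≤ kappa163 d) {p : Fin d → ℂ}
    (hp : p ∈ Strip d κ) (μ lam ν₀ : Fin d) {α : ℝ} (hα0 : 0 ≤ α) (hα1 : α < 1) :
    ∑ k : Fin d → Fin n, ‖h163 n μ lam k p‖ * wW n k p ν₀ α ≤ CHolder163 d α := by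
  classical
  have hd : 0 < d := Fin.pos μ
  have hκ1 : κ ≤ 1 := (kappa_small hκ0 (hκ.trans (kappa163_le_rOf d))).1
  have he : 1 < 1 + (1 - α) / d := by
    have : (0 : ℝ) < (1 - α) / d := div_pos (by linarith) (by exact_mod_cast hd)
    linarith
  set g : (Fin d → Fin n) → ℝ := fun k => ∏ ν, (12 * omega n (k ν) ^ (-(1 + (1 - α) / d))) with hgdef
  have hg0 : ∀ k, 0 ≤ g k := fun k =>
    Finset.prod_nonneg (fun ν _ => mul_nonneg (by norm_num) (Real.rpow_nonneg (omega_pos n (k ν) (k ν).isLt).le _))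
  have hC0 : 0 ≤ cHW d * cWt d := mul_nonneg (cHW_nonneg d) (cWt_nonneg d)
  have hbd : ∀ k : Fin d → Fin n, ‖h163 n μ lam k p‖ * wW n k p ν₀ α ≤
      (if k = (fun _ => 0) then M163 d * cWt d else 0) + cHW d * cWt d * g k := by
    intro k
    by_cases hk : k = fun _ => 0
    · rw [if_pos hk]
      subst hk
      have h1 := norm_h163_le n hκ0 hκ hp μ lam (fun _ => 0)
      have h2 := wW_zero_le n hκ1 hp ν₀ α
      have h3 : ‖h163 n μ lam (fun _ => 0) p‖ * wW n (fun _ => 0) p ν₀ α ≤ M163 d * cWt d :=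
        mul_le_mul h1 h2 (wW_nonneg n _ p ν₀ α) ((norm_nonneg _).trans h1)
      have h4 : 0 ≤ cHW d * cWt d * g (fun _ => 0) := mul_nonneg hC0 (hg0 _)
      linarith
    · rw [if_neg hk, zero_add]
      exact weighted_term_W_le n hκ0 hκ hp μ lam ν₀ k hk hα0 hα1.le
  calc ∑ k : Fin d → Fin n, ‖h163 n μ lam k p‖ * wW n k p ν₀ α
      ≤ ∑ k : Fin d → Fin n, ((if k = (fun _ => 0) then M163 d * cWt d else 0) + cHW d * cWt d * g k) :=
        Finset.sum_le_sum (fun k _ => hbd k)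
    _ = M163 d * cWt d + cHW d * cWt d * ∑ k : Fin d → Fin n, g k := by
        rw [Finset.sum_add_distrib, Finset.sum_ite_eq' Finset.univ (fun _ => (0 : Fin n)),
          if_pos (Finset.mem_univ _), Finset.mul_sum]
    _ ≤ M163 d * cWt d + cHW d * cWt d * (24 * zetaS (1 + (1 - α) / d)) ^ d := by
        have hsum : ∑ k : Fin d → Fin n, g k ≤ (24 * zetaS (1 + (1 - α) / d)) ^ d :=
          sum_prod_rpow_le163 (d := d) n he
        have := mul_le_mul_of_nonneg_left hsum hC0
        linarith
    _ = CHolder163 d α := rfl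

end WeightedSum

/-! ## §2. The Hölder-difference multiplier: side periodicity, strip bound `O((|z|_∞/n)^α)`, regularity, decay -/

section Multiplier

variable (n : ℕ) [NeZero n]

/-- the HÖLDER-DIFFERENCE MULTIPLIER of the kernel of `∂_νH_k` between the fine points `n·ȳ′ + a + z` and
`n·ȳ′ + a`: `HD_{ν,a,z}(p′) = Σ_l (e^{i(p′+l)·ηz} − 1)·e^{i(p′+l)·ηa}·∂_ν(p′+l)·h_{l;μλ}(p′)`, the displacement
phase continued to complex `p′` as King's signed character `B4StripSumsHolder.PhZ n l z p′ = Π_ν e^{i(p′_ν+l_ν)z_ν/n}`.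
[cite: Balaban1984PropagatorsI, p.29 lines 1–2 «This implies bounds on (1/|x′−x|^α)|∂_ν(H_kB)_μ(x′) − ∂_ν(H_kB)_μ(x)| (see the proof of Lemma 2.4 in [2].)» (the multiplier is our reading of that proof route: analytic continuation in p′)] [folklore] -/
def HD163 (μ lam ν : Fin d) (a : Fin d → Fin n) (z : Fin d → ℤ) (p : Fin d → ℂ) : ℂ :=
  ∑ k : Fin d → Fin n, (PhZ n k z p - 1) * (phase163 n k a p * dC n k p ν * h163 n μ lam k p)

/-- **SIDE PERIODICITY**: at a side point `Re p′_{ν₁} = −π`, `HD_{ν,a,z}(p′ + 2πe_{ν₁}) = HD_{ν,a,z}(p′)` — all four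
factors are `σ_{ν₁}`-covariant (`PhZ_tr`, `phase163_tr`, `dC_tr`, `h163_tr`). [folklore] -/
theorem HD163_tr {κ : ℝ} (hκ0 : 0 ≤ κ) (hκ : κ ≤ kappa163 d) {p : Fin d → ℂ} (hp : p ∈ Strip d κ) (ν₁ : Fin d)
    (hre : (p ν₁).re = -Real.pi) (μ lam ν : Fin d) (a : Fin d → Fin n) (z : Fin d → ℤ) :
    HD163 n μ lam ν a z (tr p ν₁) = HD163 n μ lam ν a z p := by
  unfold HD163
  have h : ∀ k : Fin d → Fin n,
      (PhZ n k z (tr p ν₁) - 1) * (phase163 n k a (tr p ν₁) * dC n k (tr p ν₁) ν * h163 n μ lam k (tr p ν₁)) =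
      (PhZ n (sigma n ν₁ k) z p - 1) *
        (phase163 n (sigma n ν₁ k) a p * dC n (sigma n ν₁ k) p ν * h163 n μ lam (sigma n ν₁ k) p) := fun k => by
    rw [PhZ_tr, phase163_tr, dC_tr, h163_tr n hκ0 hκ hp ν₁ hre μ lam k]
  simp_rw [h]
  exact Equiv.sum_comp (sigmaEquiv n ν₁)
    (fun k => (PhZ n k z p - 1) * (phase163 n k a p * dC n k p ν * h163 n μ lam k p))

/-- **HOLOMORPHY** of `HD_{ν,a,z}` at every point of the zero-free strip. [folklore] -/
theorem differentiableAt_HD163 {κ : ℝ} (hκ0 : 0 ≤ κ) (hκ : κ ≤ kappa163 d) {p : Fin d → ℂ}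
    (hp : p ∈ Strip d κ) (μ lam ν : Fin d) (a : Fin d → Fin n) (z : Fin d → ℤ) :
    DifferentiableAt ℂ (fun q : Fin d → ℂ => HD163 n μ lam ν a z q) p := by
  unfold HD163
  exact DifferentiableAt.fun_sum (fun k _ =>
    ((differentiableAt_PhZ n k z p).sub_const 1).mul
      ((((differentiable_phase163 n k a) p).mul ((differentiable_dC n k ν) p)).mul
        (differentiableAt_h163 n hκ0 hκ hp μ lam k)))

/-- `κ₁₆₃(d+1) ≤ 1/4` (`κ₁₆₃ ≤ rOf = 1/(4(d+2))`). [folklore] -/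
theorem kappa163_le_quarter (d : ℕ) : kappa163 (d + 1) ≤ 1 / 4 := by
  refine (kappa163_le_rOf (d + 1)).trans ?_
  unfold rOf
  have hd : (0 : ℝ) ≤ ((d + 1 : ℕ) : ℝ) := Nat.cast_nonneg _
  exact div_le_div_of_nonneg_left (by norm_num) (by norm_num) (by linarith)

/-- **THE STRIP HÖLDER PHASE ESTIMATE** (from `B4StripSumsHolder.holderFactor_le`): on `Strip (d+1) κ`,
`κ ≤ κ₁₆₃(d+1)`, for `z ≠ 0` with `|z_i| ≤ n` and `0 ≤ α ≤ 1`,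
`|e^{i(p′+l)·ηz} − 1| ≤ C_H(d)·(1 + W_n(l))^{α/2}·(|z|_∞/n)^α`.
[cite: Balaban1983RegularityDecay, p.585 «(1/|x−x′|^α)|e^{i(p′+l)·(x−x′)} − 1| ≦ O(1)|p′+l|^α,» (the n-uniform typed form is `B4StripSumsHolder.holderFactor_le` BY NAME; the alias-size weight in place of |p′+l|^α is ours)] [folklore] -/
theorem norm_PhZ_sub_one_le {κ : ℝ} (hκ0 : 0 ≤ κ) (hκ : κ ≤ kappa163 (d + 1)) {p : Fin (d + 1) → ℂ}
    (hp : p ∈ Strip (d + 1) κ) (k : Fin (d + 1) → Fin n) {z : Fin (d + 1) → ℤ} (hz0 : z ≠ 0)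
    (hzn : ∀ i, |z i| ≤ n) {α : ℝ} (hα0 : 0 ≤ α) (hα1 : α ≤ 1) :
    ‖PhZ n k z p - 1‖ ≤ CH d * (1 + W n k) ^ (α / 2) * (supNorm z / n) ^ α := by
  have hκ4 : κ ≤ 1 / 4 := hκ.trans (kappa163_le_quarter d)
  have hpF : p ∈ Fat (d + 1) κ := strip_subset_fat hκ0 le_rfl hp
  have hS := one_le_supNorm hz0
  have hS0 : 0 < supNorm z := by linarith
  have hn : (0 : ℝ) < n := by exact_mod_cast Nat.pos_of_ne_zero (NeZero.ne n)
  have hq : 0 < (n : ℝ) / supNorm z := div_pos hn hS0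
  have h := holderFactor_le n k hz0 hzn hα0 hα1 hκ4 hpF
  have hone : ((n : ℝ) / supNorm z) ^ α * (supNorm z / n) ^ α = 1 := by
    rw [← Real.mul_rpow hq.le (div_nonneg hS0.le hn.le), div_mul_div_comm, mul_comm (n : ℝ),
      div_self (mul_pos hS0 hn).ne', Real.one_rpow]
  calc ‖PhZ n k z p - 1‖ = ((n : ℝ) / supNorm z) ^ α * ‖PhZ n k z p - 1‖ * (supNorm z / n) ^ α := by
        rw [mul_comm (((n : ℝ) / supNorm z) ^ α), mul_assoc, hone, mul_one]
    _ ≤ CH d * (1 + W n k) ^ (α / 2) * (supNorm z / n) ^ α :=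
        mul_le_mul_of_nonneg_right h (Real.rpow_nonneg (div_nonneg hS0.le hn.le) _)

/-- **THE STRIP BOUND** `‖HD_{ν,a,z}(p′)‖ ≤ (e^κ)^{d+1}·C_H(d)·C_H(d+1,α)·(|z|_∞/n)^α` on `Strip (d+1) κ`,
`κ ≤ κ₁₆₃(d+1)`, for `z ≠ 0`, `|z_i| ≤ n`, `0 ≤ α < 1` — Hölder phase estimate × `|e^{i(p′+l)·ηa}| ≤ (e^κ)^{d+1}` ×
the `W`-weighted alias sum. [folklore] -/
theorem norm_HD163_le {κ : ℝ} (hκ0 : 0 ≤ κ) (hκ : κ ≤ kappa163 (d + 1)) {p : Fin (d + 1) → ℂ}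
    (hp : p ∈ Strip (d + 1) κ) (μ lam ν : Fin (d + 1)) (a : Fin (d + 1) → Fin n) {z : Fin (d + 1) → ℤ}
    (hz0 : z ≠ 0) (hzn : ∀ i, |z i| ≤ n) {α : ℝ} (hα0 : 0 ≤ α) (hα1 : α < 1) :
    ‖HD163 n μ lam ν a z p‖ ≤
      Real.exp κ ^ (d + 1) * CH d * CHolder163 (d + 1) α * (supNorm z / n) ^ α := by
  have hw := weighted_alias_sum_W_le n hκ0 hκ hp μ lam ν hα0 hα1
  set ρ : ℝ := (supNorm z / n) ^ α with hρ_def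
  have hρ : 0 ≤ ρ := Real.rpow_nonneg (div_nonneg (by linarith [one_le_supNorm hz0]) (Nat.cast_nonneg n)) _
  have hE : 0 ≤ Real.exp κ ^ (d + 1) := pow_nonneg (Real.exp_pos κ).le _
  have hK : 0 ≤ Real.exp κ ^ (d + 1) * CH d * ρ := mul_nonneg (mul_nonneg hE (CH_nonneg d)) hρ
  unfold HD163
  calc ‖∑ k : Fin (d + 1) → Fin n, (PhZ n k z p - 1) * (phase163 n k a p * dC n k p ν * h163 n μ lam k p)‖
      ≤ ∑ k : Fin (d + 1) → Fin n, ‖(PhZ n k z p - 1) * (phase163 n k a p * dC n k p ν * h163 n μ lam k p)‖ :=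
        norm_sum_le _ _
    _ ≤ ∑ k : Fin (d + 1) → Fin n, (Real.exp κ ^ (d + 1) * CH d * ρ) * (‖h163 n μ lam k p‖ * wW n k p ν α) := by
        refine Finset.sum_le_sum (fun k _ => ?_)
        rw [norm_mul, norm_mul, norm_mul]
        have h1 := norm_PhZ_sub_one_le n hκ0 hκ hp k hz0 hzn hα0 hα1.le
        have h2 := norm_phase163_le n hp k a
        have h3 := norm_nonneg (dC n k p ν)
        have h4 := norm_nonneg (h163 n μ lam k p)
        have h5 : 0 ≤ (1 + W n k) ^ (α / 2) := Real.rpow_nonneg (by linarith [W_nonneg n k]) _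
        unfold wW
        calc ‖PhZ n k z p - 1‖ * (‖phase163 n k a p‖ * ‖dC n k p ν‖ * ‖h163 n μ lam k p‖)
            ≤ (CH d * (1 + W n k) ^ (α / 2) * ρ) * (Real.exp κ ^ (d + 1) * ‖dC n k p ν‖ * ‖h163 n μ lam k p‖) :=
              mul_le_mul h1 (by gcongr) (by positivity) (mul_nonneg (mul_nonneg (CH_nonneg d) h5) hρ)
          _ = (Real.exp κ ^ (d + 1) * CH d * ρ) * (‖h163 n μ lam k p‖ * (‖dC n k p ν‖ * (1 + W n k) ^ (α / 2))) := by
              ring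
    _ = (Real.exp κ ^ (d + 1) * CH d * ρ) * ∑ k : Fin (d + 1) → Fin n, ‖h163 n μ lam k p‖ * wW n k p ν α := by
        rw [Finset.mul_sum]
    _ ≤ (Real.exp κ ^ (d + 1) * CH d * ρ) * CHolder163 (d + 1) α := mul_le_mul_of_nonneg_left hw hK
    _ = Real.exp κ ^ (d + 1) * CH d * CHolder163 (d + 1) α * ρ := by ring

end Multiplier

section Regular

/-- the strip constant of the Hölder-difference multipliers per unit of `(|z|_∞/n)^α`:
`MHD(d, α) = (e^{κ₁₆₃(d+1)})^{d+1}·C_H(d)·C_H(d+1, α)` (ambient dimension `d+1`). [folklore] -/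
def MHD (d : ℕ) (α : ℝ) : ℝ := Real.exp (kappa163 (d + 1)) ^ (d + 1) * CH d * CHolder163 (d + 1) α

/-- **STRIP REGULARITY OF THE HÖLDER-DIFFERENCE MULTIPLIERS** on `ℂ^{d+1}` at `κ = κ₁₆₃(d+1)` with the bound
`MHD(d,α)·(|z|_∞/n)^α` (`z ≠ 0`, `|z_i| ≤ n`, `0 ≤ α < 1`; pattern `B5Hk163TorusHolderDecay.stripRegular_D163`).
[folklore] -/
theorem stripRegular_HD163 (n : ℕ) [NeZero n] (μ lam ν : Fin (d + 1)) (a : Fin (d + 1) → Fin n)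
    {z : Fin (d + 1) → ℤ} (hz0 : z ≠ 0) (hzn : ∀ i, |z i| ≤ n) {α : ℝ} (hα0 : 0 ≤ α) (hα1 : α < 1) :
    StripRegular (d := d) (fun p : Fin (d + 1) → ℂ => HD163 n μ lam ν a z p) (kappa163 (d + 1))
      (MHD d α * (supNorm z / n) ^ α) := by
  have hκ0 : 0 ≤ kappa163 (d + 1) := (kappa163_pos _).le
  have hdiffAt : ∀ p ∈ Strip (d + 1) (kappa163 (d + 1)),
      DifferentiableAt ℂ (fun q : Fin (d + 1) → ℂ => HD163 n μ lam ν a z q) p :=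
    fun p hp => differentiableAt_HD163 n hκ0 le_rfl hp μ lam ν a z
  refine ⟨?_, ?_, ?_, ?_⟩
  · exact fun p hp => (hdiffAt p hp).continuousAt.continuousWithinAt
  · intro i q hq w hw
    have hP : i.insertNth w (ofRealVec q) ∈ Strip (d + 1) (kappa163 (d + 1)) :=
      insertNth_mem_Strip hκ0 i hq (openRect_subset_closedRect _ hw)
    exact ((hdiffAt _ hP).comp w (differentiableAt_insertNth i _ w)).differentiableWithinAt
  · intro i q hq y hy
    obtain ⟨hP, hre⟩ := insertNth_left_mem hκ0 i hq hy
    show HD163 n μ lam ν a z _ = HD163 n μ lam ν a z _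
    rw [← tr_insertNth_left]
    exact (HD163_tr n hκ0 le_rfl hP i hre μ lam ν a z).symm
  · intro p hp
    unfold MHD
    exact norm_HD163_le n hκ0 le_rfl hp μ lam ν a hz0 hzn hα0 hα1

/-- **EXPONENTIAL DECAY OF THE TORUS KERNELS** of `HD_{ν,a,z}` AT THE FULL RATE `κ₁₆₃(d+1)/(d+1)` with the Hölder
factor `(|z|_∞/n)^α` in front (`B4TorusKernel.MultiPeriod.torusKernel_descend_decay_torusMetric` BY NAME).
[cite: Balaban1983RegularityDecay, p.586 «Shifting the domain of integration in (2.49) into a complex domain in the direction of the vector x′−y, we can bound the left hand side of (2.49) by a constant depending on α multiplied by the exponential factor e^{−δ₀|x′−y|}» (METHOD location; the typed torus contour-shift engine and the rate are ours)] [folklore] -/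
theorem torusKernel_HD163_decay (n : ℕ) [NeZero n] (μ lam ν : Fin (d + 1)) (a : Fin (d + 1) → Fin n)
    {z : Fin (d + 1) → ℤ} (hz0 : z ≠ 0) (hzn : ∀ i, |z i| ≤ n) {α : ℝ} (hα0 : 0 ≤ α) (hα1 : α < 1)
    {N : Fin (d + 1) → ℕ} (hN : ∀ i, 1 ≤ N i) (x : Fin (d + 1) → ℤ) :
    ‖torusKernel (descendC (fun p : Fin (d + 1) → ℂ => HD163 n μ lam ν a z p)
        (stripRegular_HD163 n μ lam ν a hz0 hzn hα0 hα1) (kappa163_pos _).le) N x‖ ≤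
      MHD d α * (supNorm z / n) ^ α * periodConst (kappa163 (d + 1)) d *
        Real.exp (-(kappa163 (d + 1) / (d + 1) * torusSupNorm N x)) :=
  torusKernel_descend_decay_torusMetric _ (kappa163_pos _) hN x

end Regular

/-! ## §3. The dictionary: the Hölder difference of the kernel of `∂_νH_k` is the torus kernel of `HD` -/

section Dictionary

variable (n : ℕ) [NeZero n] (M : Fin d → ℕ) [hM : ∀ μ, NeZero (M μ)]

/-- the Hölder difference of the kernel as the torus momentum sum of `HD_{ν,a,z}`:
`hdgker a z w = |T₁|⁻¹ Σ_{p′} e^{ip′·w} HD_{ν,a,z}(p′)`. [folklore] -/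
def hdgker (μ lam ν : Fin d) (a : Fin d → Fin n) (z : Fin d → ℤ) (w : Tor M) : ℂ :=
  ((Fintype.card (Tor M) : ℂ))⁻¹ * ∑ q : Tor M, chi M q w * HD163 n μ lam ν a z (ofRealVec (sOf M q))

/-- AT GRID MOMENTA KING'S SIGNED CHARACTER IS THE FINE TORUS CHARACTER OF `p′+l` AT `z̄`:
`PhZ n l z (p′) = e^{i(p′+l)·ηz}` (`B5Hk163TorusHolder.stdAddChar_pOf_mul_intCast` per coordinate). [folklore] -/
theorem PhZ_ofRealVec_sOf (k : Fin d → Fin n) (q : Tor M) (z : Fin d → ℤ) :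
    PhZ n k z (ofRealVec (sOf M q)) = chi (fine n M) (pOf n M (k, q)) (toT (fine n M) z) := by
  unfold PhZ chi
  refine Finset.prod_congr rfl fun ν _ => ?_
  rw [show toT (fine n M) z ν = ((z ν : ℤ) : ZMod (fine n M ν)) from rfl, stdAddChar_pOf_mul_intCast]
  unfold efZ
  congr 1
  simp only [ofRealVec, shiftr]
  push_cast
  ring

/-- splitting a coarse character at a difference: `e^{ip′(y′−y)} = e^{ip′y′}·conj e^{ip′y}`. [folklore] -/
theorem chi_sub_right (q y' y : Tor M) : chi M q (y' - y) = chi M q y' * conj (chi M q y) := by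
  rw [conj_chi, chi_neg_comm, sub_eq_add_neg, chi_add_right]

/-- **THE DICTIONARY FOR THE HÖLDER DIFFERENCE**: for a block point `n·ȳ′ + a` and an integer displacement `z`,
`∂_νH_k((n·ȳ′ + a + z̄, μ), (y, λ)) − ∂_νH_k((n·ȳ′ + a, μ), (y, λ)) = hdgker a z (y′ − y)`
(`B5Hk163TorusHolder.dker_transl_sub` + the `dker_bpt` rewriting + `PhZ_ofRealVec_sOf`). [folklore] -/
theorem dker_transl_sub_bpt (μ lam ν : Fin d) (y' : Tor M) (a : Fin d → Fin n) (z : Fin d → ℤ) (y : Tor M) :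
    dker n M μ lam ν (bpt n M y' a + toT (fine n M) z) y - dker n M μ lam ν (bpt n M y' a) y
      = hdgker n M μ lam ν a z (y' - y) := by
  rw [dker_transl_sub]
  unfold hdgker HD163
  congr 1
  rw [Fintype.sum_prod_type, Finset.sum_comm]
  refine Finset.sum_congr rfl fun q _ => ?_
  rw [Finset.mul_sum]
  refine Finset.sum_congr rfl fun k _ => ?_
  dsimp only
  rw [bpt, chi_add_right, chi_pOf_up, ← phase163_sOf, chi_sub_right, dC_ofReal, PhZ_ofRealVec_sOf]
  ring

end Dictionary

/-! ## §5a. Uniform torus sums of the decay factors (for the sup form) -/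

section TorusSum

variable (M : Fin (d + 1) → ℕ) [hM : ∀ μ, NeZero (M μ)]

/-- the box representative of a residue class IS its `torFin` grid coordinate vector. [folklore] -/
theorem toZ_torFin (t : Tor M) : toZ (torFin M t) = rep M t := rfl

/-- reducing an integer point to its box representative is a period translation: `y = rep(ȳ) + M·m`.
[folklore] -/
theorem exists_eq_translate_rep (y : Fin (d + 1) → ℤ) :
    ∃ m : Fin (d + 1) → ℤ, y = translate M (rep M (toT M y)) m := by
  refine ⟨fun i => y i / M i, funext fun i => ?_⟩
  simp only [B4TorusKernel.MultiPeriod.translate_apply, rep, B6LowerBound2153Torus.toT]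
  rw [ZMod.val_intCast]
  have h := Int.emod_add_ediv_mul (y i) (M i)
  linarith [mul_comm (y i / (M i : ℤ)) (M i : ℤ)]

/-- the torus distance from an integer point to a residue class, through box representatives, is the grid
distance `tdist` of `B4Sect5Torus` (via `B5DPD126Uniform.tdist_eq_torusSupNorm`). [folklore] -/
theorem torusSupNorm_sub_rep (y : Fin (d + 1) → ℤ) (t : Tor M) :
    torusSupNorm M (y - rep M t) = tdist M (torFin M (toT M y)) (torFin M t) := by
  obtain ⟨m, hm⟩ := exists_eq_translate_rep M y
  rw [tdist_eq_torusSupNorm (one_le_M M), toZ_torFin, toZ_torFin]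
  have h : y - rep M t = translate M (rep M (toT M y) - rep M t) m := by
    conv_lhs => rw [hm]
    funext i
    simp only [Pi.sub_apply, B4TorusKernel.MultiPeriod.translate_apply]
    ring
  rw [h, torusSupNorm_translate]

/-- **UNIFORM TORUS SUM**: `Σ_{t ∈ T₁} e^{−a |y − rep t|_T} ≤ K_{d+1}(a)` for every `a > 0` and every integer point
`y`, INDEPENDENTLY of the period vector `M` (`B4Sect5Torus.torusSum_le`, transported along `torFin`). [folklore] -/
theorem sum_exp_torusSupNorm_sub_rep_le {a : ℝ} (ha : 0 < a) (y : Fin (d + 1) → ℤ) :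
    ∑ t : Tor M, Real.exp (-(a * torusSupNorm M (y - rep M t))) ≤ latticeConst (d + 1) a := by
  have h := B4Sect5Torus.torusSum_le (d + 1) (one_le_M M) ha (torFin M (toT M y))
  calc ∑ t : Tor M, Real.exp (-(a * torusSupNorm M (y - rep M t)))
      = ∑ k : ((i : Fin (d + 1)) → Fin (M i)), Real.exp (-(a * tdist M (torFin M (toT M y)) k)) := by
        refine Fintype.sum_equiv (torFin M) _ _ fun t => ?_
        rw [torusSupNorm_sub_rep M]
    _ ≤ latticeConst (d + 1) a := h

end TorusSum

/-! ## §4. The decaying Hölder bound at the full rate -/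

section Main

variable (n : ℕ) [NeZero n] (M : Fin (d + 1) → ℕ) [hM : ∀ μ, NeZero (M μ)]

/-- the two grid momentum conventions give the same value of `HD_{ν,a,z}` (pattern
`B5Hk163TorusHolderDecay.D163_grid_eq`: `B4TorusKernel.face_match` + `stripRegular_HD163`). [folklore] -/
theorem HD163_grid_eq (μ lam ν : Fin (d + 1)) (a : Fin (d + 1) → Fin n) {z : Fin (d + 1) → ℤ} (hz0 : z ≠ 0)
    (hzn : ∀ i, |z i| ≤ n) {α : ℝ} (hα0 : 0 ≤ α) (hα1 : α < 1) (t : Tor M) :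
    HD163 n μ lam ν a z
        (ofRealVec (fun i => 2 * Real.pi * B4TorusKernel.rep ((((torFin M t i : ℕ) : ℝ) / M i : ℝ) : UnitAddCircle)))
      = HD163 n μ lam ν a z (ofRealVec (sOf M t)) := by
  classical
  set u : Fin (d + 1) → ℝ :=
    fun i => 2 * Real.pi * B4TorusKernel.rep ((((torFin M t i : ℕ) : ℝ) / M i : ℝ) : UnitAddCircle) with hu_def
  have hdich : ∀ i, u i = sOf M t i ∨ (u i = -Real.pi ∧ sOf M t i = Real.pi) := fun i => two_pi_rep_grid M t i
  have hu : u ∈ BZ (d + 1) := by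
    refine ⟨fun i => ?_, fun i => ?_⟩
    · have h := (rep_mem (((((torFin M t i : ℕ) : ℝ) / M i : ℝ) : UnitAddCircle))).1
      show -Real.pi ≤ 2 * Real.pi * _
      nlinarith [Real.pi_pos]
    · have h := (rep_mem (((((torFin M t i : ℕ) : ℝ) / M i : ℝ) : UnitAddCircle))).2
      show 2 * Real.pi * _ ≤ Real.pi
      nlinarith [Real.pi_pos]
  have hv : sOf M t ∈ BZ (d + 1) :=
    ⟨fun i => (abs_le.mp (abs_sOf_le M t i)).1, fun i => (abs_le.mp (abs_sOf_le M t i)).2⟩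
  refine face_match (stripRegular_HD163 n μ lam ν a hz0 hzn hα0 hα1) (kappa163_pos _).le
    (Finset.univ.filter fun i => u i ≠ sOf M t i) u (sOf M t) hu hv (fun i hi => ?_) (fun i hi => ?_)
  · by_contra h
    exact hi (Finset.mem_filter.mpr ⟨Finset.mem_univ _, h⟩)
  · have h := (Finset.mem_filter.mp hi).2
    rcases hdich i with h' | h'
    · exact absurd h' h
    · exact h'

/-- the Hölder difference kernel is the torus kernel of `HD_{ν,a,z}` (pattern
`B5Hk163TorusHolderDecay.dgker_toT_eq_torusKernel`). [folklore] -/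
theorem hdgker_toT_eq_torusKernel (μ lam ν : Fin (d + 1)) (a : Fin (d + 1) → Fin n) {z : Fin (d + 1) → ℤ}
    (hz0 : z ≠ 0) (hzn : ∀ i, |z i| ≤ n) {α : ℝ} (hα0 : 0 ≤ α) (hα1 : α < 1) (x : Fin (d + 1) → ℤ) :
    hdgker n M μ lam ν a z (toT M x)
      = torusKernel (descendC (fun p : Fin (d + 1) → ℂ => HD163 n μ lam ν a z p)
          (stripRegular_HD163 n μ lam ν a hz0 hzn hα0 hα1) (kappa163_pos _).le) M x := by
  unfold hdgker torusKernel torusSum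
  rw [card_Tor_cast]
  congr 1
  refine Fintype.sum_equiv (torFin M) _ _ fun t => ?_
  rw [descendC_apply, B4TorusKernel.MultiPeriod.descend_gridPt, chi_toT_eq_mFourier, mul_comm]
  congr 1
  exact (HD163_grid_eq n M μ lam ν a hz0 hzn hα0 hα1 t).symm

/-- **THE SMALL-DISPLACEMENT CASE**: for `0 < |z|_∞ ≤ n`, lattice representatives `x′, x` and `0 ≤ α < 1`,
`|∂_νH_k((n·x̄′+a+z̄, μ), (x̄, λ)) − ∂_νH_k((n·x̄′+a, μ), (x̄, λ))|
   ≤ MHD(d,α)·(|z|_∞/n)^α·periodConst·e^{−(κ₁₆₃(d+1)/(d+1))|x′−x|_{T,∞}}` — the FULL decay rate, independent of `α`.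
[cite: Balaban1984PropagatorsI, p.29 lines 1–2 «(see the proof of Lemma 2.4 in [2].)» (METHOD location: analytic continuation and contour shift of the Hölder-difference multiplier; typed torus form and constants ours)] [folklore] -/
theorem norm_dker_transl_sub_bpt_le (μ lam ν : Fin (d + 1)) (a : Fin (d + 1) → Fin n) {z : Fin (d + 1) → ℤ}
    (hz0 : z ≠ 0) (hzn : ∀ i, |z i| ≤ n) {α : ℝ} (hα0 : 0 ≤ α) (hα1 : α < 1) (x' x : Fin (d + 1) → ℤ) :
    ‖dker n M μ lam ν (bpt n M (toT M x') a + toT (fine n M) z) (toT M x) - dker n M μ lam ν (bpt n M (toT M x') a) (toT M x)‖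
      ≤ MHD d α * (supNorm z / n) ^ α * periodConst (kappa163 (d + 1)) d *
          Real.exp (-(kappa163 (d + 1) / (d + 1) * torusSupNorm M (x' - x))) := by
  rw [dker_transl_sub_bpt, toT_sub, hdgker_toT_eq_torusKernel n M μ lam ν a hz0 hzn hα0 hα1]
  exact torusKernel_HD163_decay n μ lam ν a hz0 hzn hα0 hα1 (one_le_M M) (x' - x)

/-- `|z|_∞ ≤ ‖z‖₂`. [folklore] -/
theorem supNorm_le_zlen (z : Fin (d + 1) → ℤ) : supNorm z ≤ zlen z := by
  unfold supNorm zlen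
  refine Finset.sup'_le _ _ fun i _ => ?_
  rw [show (((|z i| : ℤ)) : ℝ) = Real.sqrt (((z i : ℝ)) ^ 2) by
    rw [Real.sqrt_sq_eq_abs, Int.cast_abs]]
  exact Real.sqrt_le_sqrt (Finset.single_le_sum (fun j _ => sq_nonneg ((z j : ℝ))) (Finset.mem_univ i))

/-- `MHD(d,α)·periodConst ≥ 0` — read off the kernel bound at `n = 1`, `M = 1`, `z = e₀`. [folklore] -/
theorem MHD_mul_periodConst_nonneg {α : ℝ} (hα0 : 0 ≤ α) (hα1 : α < 1) :
    0 ≤ MHD d α * periodConst (kappa163 (d + 1)) d := by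
  have hz0 : (fun i : Fin (d + 1) => (1 : ℤ)) ≠ 0 := by
    intro h; have := congr_fun h 0; simp at this
  have hzn : ∀ i : Fin (d + 1), |(fun _ : Fin (d + 1) => (1 : ℤ)) i| ≤ (1 : ℕ) := fun i => by simp
  have h := (norm_nonneg _).trans
    (norm_dker_transl_sub_bpt_le 1 (fun _ : Fin (d + 1) => 1) 0 0 0 (fun _ => 0) hz0 hzn hα0 hα1 0 0)
  have hS : supNorm (fun _ : Fin (d + 1) => (1 : ℤ)) = 1 := by
    apply le_antisymm
    · exact Finset.sup'_le _ _ fun i _ => by simp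
    · simpa using abs_le_supNorm (fun _ : Fin (d + 1) => (1 : ℤ)) 0
  rw [hS, Nat.cast_one, div_one, Real.one_rpow, mul_one] at h
  have hE := Real.exp_pos (-(kappa163 (d + 1) / (d + 1) * torusSupNorm (fun _ : Fin (d + 1) => 1) (0 - 0)))
  by_contra hneg
  have hneg : MHD d α * periodConst (kappa163 (d + 1)) d < 0 := lt_of_not_ge hneg
  have : MHD d α * periodConst (kappa163 (d + 1)) d *
      Real.exp (-(kappa163 (d + 1) / (d + 1) * torusSupNorm (fun _ : Fin (d + 1) => 1) (0 - 0))) < 0 :=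
    mul_neg_of_neg_of_pos hneg hE
  linarith

/-- the full-rate Hölder constant `CHR(d,α) = max(MHD·periodConst, 2·CdecD)` (small / large displacements). [folklore] -/
def CHR (d : ℕ) (α : ℝ) : ℝ := max (MHD d α * periodConst (kappa163 (d + 1)) d) (2 * CdecD d)

/-- `CHR ≥ 0`. [folklore] -/
theorem CHR_nonneg (α : ℝ) : 0 ≤ CHR d α := le_max_of_le_right (mul_nonneg (by norm_num) CdecD_nonneg)

/-- **THE DECAYING HÖLDER BOUND FOR THE KERNEL OF THE TYPED `∂_νH_k` AT THE FULL RATE** (torus model, dimension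
`d+1 ≥ 1`, uniformly in `n ≥ 1` and in the period vector): for fine points `x₁ = n·ȳ₁ + a₁`,
`x₂ = n·ȳ₂ + a₂ = x₁ + z̄` (`z ∈ ℤ^{d+1}` any representative of the displacement), every coarse point `x̄` and
`0 ≤ α < 1`,
`|∂_νH_k((x₂, μ), (x̄, λ)) − ∂_νH_k((x₁, μ), (x̄, λ))| ≤ CHR(d,α)·(|z|_∞/n)^α·max(e^{−δ|y₂−x|_{T,∞}}, e^{−δ|y₁−x|_{T,∞}})`
with the FULL rate `δ = κ₁₆₃(d+1)/(d+1)` (no interpolation loss): for `0 < |z|_∞ ≤ n` the contour shift of the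
Hölder-difference multiplier (`norm_dker_transl_sub_bpt_le`), for `|z|_∞ > n` the two decaying sup bounds
(`B5Hk163TorusHolderDecay.norm_dker_bpt_le`) and `(|z|_∞/n)^α ≥ 1`, for `z = 0` nothing to prove.
[cite: Balaban1984PropagatorsI, p.29 lines 1–2 «This implies bounds on (1/|x′−x|^α)|∂_ν(H_kB)_μ(x′) − ∂_ν(H_kB)_μ(x)| (see the proof of Lemma 2.4 in [2].)» (typed torus reading, route and constants ours)] [folklore] -/
theorem norm_dker_sub_le_rate (μ lam ν : Fin (d + 1)) (y₁ y₂ x : Fin (d + 1) → ℤ)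
    (a₁ a₂ : Fin (d + 1) → Fin n) (z : Fin (d + 1) → ℤ)
    (hz : bpt n M (toT M y₂) a₂ = bpt n M (toT M y₁) a₁ + toT (fine n M) z) {α : ℝ} (hα0 : 0 ≤ α) (hα1 : α < 1) :
    ‖dker n M μ lam ν (bpt n M (toT M y₂) a₂) (toT M x) - dker n M μ lam ν (bpt n M (toT M y₁) a₁) (toT M x)‖
      ≤ CHR d α * (supNorm z / n) ^ α *
          max (Real.exp (-(kappa163 (d + 1) / (d + 1) * torusSupNorm M (y₂ - x))))
              (Real.exp (-(kappa163 (d + 1) / (d + 1) * torusSupNorm M (y₁ - x)))) := by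
  set E₂ := Real.exp (-(kappa163 (d + 1) / (d + 1) * torusSupNorm M (y₂ - x))) with hE₂
  set E₁ := Real.exp (-(kappa163 (d + 1) / (d + 1) * torusSupNorm M (y₁ - x))) with hE₁
  have hn : (0 : ℝ) < n := by exact_mod_cast Nat.pos_of_ne_zero (NeZero.ne n)
  have hρ0 : 0 ≤ (supNorm z / n) ^ α := Real.rpow_nonneg (div_nonneg (supNorm_nonneg z) hn.le) _
  have hm0 : 0 ≤ max E₂ E₁ := le_max_of_le_left (Real.exp_pos _).le
  have hC0 : 0 ≤ CdecD d := CdecD_nonneg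
  have hP0 := MHD_mul_periodConst_nonneg (d := d) hα0 hα1
  by_cases hz0 : z = 0
  · -- no displacement
    subst hz0
    have h0 : toT (fine n M) (0 : Fin (d + 1) → ℤ) = 0 := by
      ext i; simp [B6LowerBound2153Torus.toT]
    rw [h0, add_zero] at hz
    rw [hz, sub_self, norm_zero]
    exact mul_nonneg (mul_nonneg (CHR_nonneg α) hρ0) hm0
  by_cases hzn : ∀ i, |z i| ≤ n
  · -- small displacement: contour shift of the Hölder-difference multiplier
    have h := norm_dker_transl_sub_bpt_le n M μ lam ν a₁ hz0 hzn hα0 hα1 y₁ x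
    rw [← hz] at h
    calc _ ≤ MHD d α * (supNorm z / n) ^ α * periodConst (kappa163 (d + 1)) d * E₁ := h
      _ = (MHD d α * periodConst (kappa163 (d + 1)) d) * (supNorm z / n) ^ α * E₁ := by ring
      _ ≤ CHR d α * (supNorm z / n) ^ α * max E₂ E₁ :=
          mul_le_mul (mul_le_mul_of_nonneg_right (le_max_left _ _) hρ0) (le_max_right _ _) (Real.exp_pos _).le
            (mul_nonneg (CHR_nonneg α) hρ0)
  · -- large displacement: two decaying sup bounds, `(|z|_∞/n)^α ≥ 1`
    obtain ⟨i, hi⟩ := not_forall.mp hzn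
    have hi' : (n : ℤ) < |z i| := not_le.mp hi
    have hρ1 : 1 ≤ (supNorm z / n) ^ α := by
      have h1 : (n : ℝ) ≤ supNorm z := by
        have h3 : ((n : ℤ) : ℝ) ≤ (((|z i| : ℤ)) : ℝ) := Int.cast_le.mpr hi'.le
        have h2 := abs_le_supNorm z i
        rw [Int.cast_natCast] at h3
        linarith
      exact Real.one_le_rpow ((one_le_div hn).mpr h1) hα0
    have h2 := norm_dker_bpt_le n M μ lam ν a₂ y₂ x
    have h1 := norm_dker_bpt_le n M μ lam ν a₁ y₁ x
    calc _ ≤ ‖dker n M μ lam ν (bpt n M (toT M y₂) a₂) (toT M x)‖ +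
          ‖dker n M μ lam ν (bpt n M (toT M y₁) a₁) (toT M x)‖ := norm_sub_le _ _
      _ ≤ CdecD d * E₂ + CdecD d * E₁ := by unfold CdecD; exact add_le_add h2 h1
      _ ≤ CdecD d * max E₂ E₁ + CdecD d * max E₂ E₁ :=
          add_le_add (mul_le_mul_of_nonneg_left (le_max_left _ _) hC0)
            (mul_le_mul_of_nonneg_left (le_max_right _ _) hC0)
      _ = (2 * CdecD d) * 1 * max E₂ E₁ := by ring
      _ ≤ CHR d α * (supNorm z / n) ^ α * max E₂ E₁ :=
          mul_le_mul_of_nonneg_right (mul_le_mul (le_max_right _ _) hρ1 zero_le_one (CHR_nonneg α)) hm0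

/-- the same bound with the EUCLIDEAN length of the displacement, `(‖z‖₂/n)^α ≥ (|z|_∞/n)^α` (the form of
`B5Hk163TorusHolder` / `B5Hk163TorusHolderDecay`). [folklore] -/
theorem norm_dker_sub_le_rate_euclid (μ lam ν : Fin (d + 1)) (y₁ y₂ x : Fin (d + 1) → ℤ)
    (a₁ a₂ : Fin (d + 1) → Fin n) (z : Fin (d + 1) → ℤ)
    (hz : bpt n M (toT M y₂) a₂ = bpt n M (toT M y₁) a₁ + toT (fine n M) z) {α : ℝ} (hα0 : 0 ≤ α) (hα1 : α < 1) :
    ‖dker n M μ lam ν (bpt n M (toT M y₂) a₂) (toT M x) - dker n M μ lam ν (bpt n M (toT M y₁) a₁) (toT M x)‖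
      ≤ CHR d α * (zlen z / n) ^ α *
          max (Real.exp (-(kappa163 (d + 1) / (d + 1) * torusSupNorm M (y₂ - x))))
              (Real.exp (-(kappa163 (d + 1) / (d + 1) * torusSupNorm M (y₁ - x)))) := by
  refine (norm_dker_sub_le_rate n M μ lam ν y₁ y₂ x a₁ a₂ z hz hα0 hα1).trans ?_
  have hn : (0 : ℝ) ≤ n := Nat.cast_nonneg n
  have hρ : (supNorm z / n) ^ α ≤ (zlen z / n) ^ α :=
    Real.rpow_le_rpow (div_nonneg (supNorm_nonneg z) hn) (div_le_div_of_nonneg_right (supNorm_le_zlen z) hn) hα0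
  exact mul_le_mul_of_nonneg_right (mul_le_mul_of_nonneg_left hρ (CHR_nonneg α))
    (le_max_of_le_left (Real.exp_pos _).le)

/-- **THE FULL-RATE DECAYING HÖLDER BOUND FOR THE TYPED OPERATOR** (exponentially weighted `ℓ¹` form): for every
unit-lattice 1-form `B`, fine points `x₁ = n·ȳ₁ + a₁`, `x₂ = n·ȳ₂ + a₂ = x₁ + z̄`, any family of lattice
representatives `r : T₁ → ℤ^{d+1}` and `0 ≤ α < 1`,
`|∂_ν(H_kB)_μ(x₂) − ∂_ν(H_kB)_μ(x₁)| ≤ CHR(d,α)·(|z|_∞/n)^α·Σ_{y,λ} max(e^{−δ|y₂−r(y)|_T}, e^{−δ|y₁−r(y)|_T})·|B_λ(y)|`,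
`δ = κ₁₆₃(d+1)/(d+1)`.
[cite: Balaban1984PropagatorsI, p.29 lines 1–2 «This implies bounds on (1/|x′−x|^α)|∂_ν(H_kB)_μ(x′) − ∂_ν(H_kB)_μ(x)| (see the proof of Lemma 2.4 in [2].)» (text of the claim only; typed form, proof and constants ours)] [folklore] -/
theorem norm_fdiff_HkOp_mulVec_sub_le_rate (B : Tor M × Fin (d + 1) → ℂ) (μ ν : Fin (d + 1))
    (y₁ y₂ : Fin (d + 1) → ℤ) (a₁ a₂ : Fin (d + 1) → Fin n) (z : Fin (d + 1) → ℤ)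
    (hz : bpt n M (toT M y₂) a₂ = bpt n M (toT M y₁) a₁ + toT (fine n M) z)
    (r : Tor M → (Fin (d + 1) → ℤ)) (hr : ∀ y, toT M (r y) = y) {α : ℝ} (hα0 : 0 ≤ α) (hα1 : α < 1) :
    ‖(fdiff (fine n M) (n : ℂ) ν *ᵥ (HkOp n M *ᵥ B)) (bpt n M (toT M y₂) a₂, μ)
        - (fdiff (fine n M) (n : ℂ) ν *ᵥ (HkOp n M *ᵥ B)) (bpt n M (toT M y₁) a₁, μ)‖
      ≤ CHR d α * (supNorm z / n) ^ α *
          ∑ y : Tor M, ∑ lam : Fin (d + 1),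
            max (Real.exp (-(kappa163 (d + 1) / (d + 1) * torusSupNorm M (y₂ - r y))))
                (Real.exp (-(kappa163 (d + 1) / (d + 1) * torusSupNorm M (y₁ - r y)))) * ‖B (y, lam)‖ := by
  rw [fdiff_HkOp_mulVec, fdiff_HkOp_mulVec, ← Finset.sum_sub_distrib]
  simp_rw [← Finset.sum_sub_distrib, ← sub_mul]
  rw [Finset.mul_sum]
  refine (norm_sum_le _ _).trans (Finset.sum_le_sum fun y _ => ?_)
  rw [Finset.mul_sum]
  refine (norm_sum_le _ _).trans (Finset.sum_le_sum fun lam _ => ?_)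
  rw [norm_mul, ← mul_assoc]
  refine mul_le_mul_of_nonneg_right ?_ (norm_nonneg _)
  have h := norm_dker_sub_le_rate n M μ lam ν y₁ y₂ (r y) a₁ a₂ z hz hα0 hα1
  rw [hr y] at h
  exact h

/-! ## §5. The volume-uniform sup form -/

/-- the volume-uniform full-rate sup-form constant `CHR(d,α)·2(d+1)·K_{d+1}(δ)`, `δ = κ₁₆₃(d+1)/(d+1)`. [folklore] -/
def CHRsup (d : ℕ) (α : ℝ) : ℝ := CHR d α * (2 * ((d : ℝ) + 1) * latticeConst (d + 1) (kappa163 (d + 1) / (d + 1)))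

/-- **HÖLDER CONTINUITY OF THE TYPED `∂_ν H_k` AGAINST `sup |B|`, UNIFORMLY IN THE VOLUME, WITH AN
`α`-INDEPENDENT GEOMETRY**: for `|B| ≤ b` pointwise, fine points `x₁ = n·ȳ₁ + a₁`, `x₂ = n·ȳ₂ + a₂ = x₁ + z̄`
as above and `0 ≤ α < 1`,
`|∂_ν(H_k B)_μ(x₂) − ∂_ν(H_k B)_μ(x₁)| ≤ CHRsup(d,α)·(|z|_∞/n)^α·b` (the `ℓ¹` form with `r = rep`, `max ≤ Σ`, and
the uniform torus sum `sum_exp_torusSupNorm_sub_rep_le` of §5a at the full rate).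
[cite: Balaban1984PropagatorsI, p.29 lines 1–2 «This implies bounds on (1/|x′−x|^α)|∂_ν(H_kB)_μ(x′) − ∂_ν(H_kB)_μ(x)|» (a consequence in our typed torus model)] [folklore] -/
theorem norm_fdiff_HkOp_mulVec_sub_le_rate_sup (B : Tor M × Fin (d + 1) → ℂ) {b : ℝ}
    (hB : ∀ y lam, ‖B (y, lam)‖ ≤ b) (μ ν : Fin (d + 1)) (y₁ y₂ : Fin (d + 1) → ℤ) (a₁ a₂ : Fin (d + 1) → Fin n)
    (z : Fin (d + 1) → ℤ) (hz : bpt n M (toT M y₂) a₂ = bpt n M (toT M y₁) a₁ + toT (fine n M) z)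
    {α : ℝ} (hα0 : 0 ≤ α) (hα1 : α < 1) :
    ‖(fdiff (fine n M) (n : ℂ) ν *ᵥ (HkOp n M *ᵥ B)) (bpt n M (toT M y₂) a₂, μ)
        - (fdiff (fine n M) (n : ℂ) ν *ᵥ (HkOp n M *ᵥ B)) (bpt n M (toT M y₁) a₁, μ)‖
      ≤ CHRsup d α * (supNorm z / n) ^ α * b := by
  have hmain := norm_fdiff_HkOp_mulVec_sub_le_rate n M B μ ν y₁ y₂ a₁ a₂ z hz (rep M) (toT_rep M) hα0 hα1
  set δ : ℝ := kappa163 (d + 1) / (d + 1) with hδ_def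
  have hδ : 0 < δ := div_pos (kappa163_pos (d + 1)) (by positivity)
  have hb : 0 ≤ b := (norm_nonneg _).trans (hB 0 0)
  have hK := sum_exp_torusSupNorm_sub_rep_le M hδ
  have hn : (0 : ℝ) < n := by exact_mod_cast Nat.pos_of_ne_zero (NeZero.ne n)
  have hS : ∑ y : Tor M, ∑ lam : Fin (d + 1),
        max (Real.exp (-(δ * torusSupNorm M (y₂ - rep M y)))) (Real.exp (-(δ * torusSupNorm M (y₁ - rep M y))))
          * ‖B (y, lam)‖
      ≤ ((d : ℝ) + 1) * b * (2 * latticeConst (d + 1) δ) := by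
    calc ∑ y : Tor M, ∑ lam : Fin (d + 1),
          max (Real.exp (-(δ * torusSupNorm M (y₂ - rep M y)))) (Real.exp (-(δ * torusSupNorm M (y₁ - rep M y))))
            * ‖B (y, lam)‖
        ≤ ∑ y : Tor M, ∑ _lam : Fin (d + 1),
            (Real.exp (-(δ * torusSupNorm M (y₂ - rep M y))) + Real.exp (-(δ * torusSupNorm M (y₁ - rep M y))))
              * b := by
          refine Finset.sum_le_sum fun y _ => Finset.sum_le_sum fun lam _ => ?_
          refine mul_le_mul ?_ (hB y lam) (norm_nonneg _) (by positivity)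
          exact max_le_add_of_nonneg (Real.exp_pos _).le (Real.exp_pos _).le
      _ = ((d : ℝ) + 1) * b * ((∑ y : Tor M, Real.exp (-(δ * torusSupNorm M (y₂ - rep M y))))
              + ∑ y : Tor M, Real.exp (-(δ * torusSupNorm M (y₁ - rep M y)))) := by
          rw [← Finset.sum_add_distrib, Finset.mul_sum]
          refine Finset.sum_congr rfl fun y _ => ?_
          rw [Finset.sum_const, Finset.card_univ, Fintype.card_fin, nsmul_eq_mul]
          push_cast
          ring
      _ ≤ ((d : ℝ) + 1) * b * (2 * latticeConst (d + 1) δ) := by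
          refine mul_le_mul_of_nonneg_left ?_ (by positivity)
          linarith [hK y₂, hK y₁]
  have hC : 0 ≤ CHR d α * (supNorm z / n) ^ α :=
    mul_nonneg (CHR_nonneg α) (Real.rpow_nonneg (div_nonneg (supNorm_nonneg z) hn.le) _)
  calc _ ≤ _ := hmain
    _ ≤ CHR d α * (supNorm z / n) ^ α * (((d : ℝ) + 1) * b * (2 * latticeConst (d + 1) δ)) :=
        mul_le_mul_of_nonneg_left hS hC
    _ = CHRsup d α * (supNorm z / n) ^ α * b := by
        simp only [CHRsup, hδ_def]
        ring

end Main

end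

end Literature.MathematicalPhysics.QuantumFieldTheory.Balaban1983to89.B5Hk163TorusHolderRate
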